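import Summits.ValiantsHypothesis.ValiantsHypothesis.Theorems.BinomialElusivePeelingLemmaWindowDefs
import Summits.ValiantsHypothesis.ValiantsHypothesis.Theorems.BinomialElusivePeelingLemmaSchottky

/-!
# Girth of the Cayley letter incidence (module [G], part 2)

Helper for the crux stmt-ValiantsHypothesis-7391 (negative lane; `Cruxes/PeelingLemma/DETERMINISTIC-ALLX.md`
§4–§5).  The letter incidence of the derandomised all-X refutation is the bipartite double cover of
the Cayley graph of `SL(2, ℤ/p)` on the reductions of the free generators `T(4(j+1))^{±1}`
(`BinomialElusivePeelingLemmaSchottky.lean`): gadget `g` carries the letters `(g · π(T_j^{±1}), col j)`.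
Here: entries of the image of a word of length `k` are `≤ (2G)^k`, `G = 32D² + 8D + 2`
(`abs_lift_mk_le`); a nonempty reduced word is `≠ 1` in `SL(2,ℤ)` (freeness) and hence `≠ 1` mod `p`
once `p > (2G)^k + 1` (`map_lift_ne_one`); and a closed alternating walk of length `L`, non-backtracking
at interior points, in the incidence IS a nonempty reduced word of length `2L` with trivial image —
so the incidence satisfies the girth hypothesis `¬ HasShortClosedWalk Λ N` of the counting lemma
`PeelingLemmaGirth.three_pow_le_card` as soon as `p > (2G)^{2N} + 1` (`not_hasShortClosedWalk_cayley`).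
Elementary (Margulis; Davidoff–Sarnak–Valette App. A); no Theses import.
-/

namespace Summit.ValiantsHypothesis.ValiantsHypothesis.Theorems.PeelingLemmaSchottky

-- summit = sub-problem name (single-conjunct summit, D-0017 layout), so the namespace repeats it
set_option linter.dupNamespace false

open Matrix
open Summit.ValiantsHypothesis.ValiantsHypothesis.Theorems.PeelingLemmaGirth (HasShortClosedWalk)

/-! ## Entry growth along words -/

/-- Entries of a product of `2 × 2` integer matrices. -/
theorem abs_mul_entry_le {A B : Matrix (Fin 2) (Fin 2) ℤ} {a b : ℤ} (hA : ∀ i j, |A i j| ≤ a)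
    (hB : ∀ i j, |B i j| ≤ b) (i j : Fin 2) : |(A * B) i j| ≤ 2 * a * b := by
  have ha : 0 ≤ a := (abs_nonneg _).trans (hA 0 0)
  rw [Matrix.mul_apply, Fin.sum_univ_two]
  calc |A i 0 * B 0 j + A i 1 * B 1 j| ≤ |A i 0 * B 0 j| + |A i 1 * B 1 j| := abs_add_le _ _
    _ = |A i 0| * |B 0 j| + |A i 1| * |B 1 j| := by rw [abs_mul, abs_mul]
    _ ≤ a * b + a * b := add_le_add (mul_le_mul (hA _ _) (hB _ _) (abs_nonneg _) ha)
        (mul_le_mul (hA _ _) (hB _ _) (abs_nonneg _) ha)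
    _ = 2 * a * b := by ring

/-- The signed generator `x = (j, ε)`: `T(4(j+1))` or its inverse (the convention of `FreeGroup.lift`). -/
theorem abs_sgen_le (D : ℕ) (x : Fin D × Bool) (i j : Fin 2) :
    |((cond x.2 (gen D x.1) (gen D x.1)⁻¹ : Matrix.SpecialLinearGroup (Fin 2) ℤ) :
        Matrix (Fin 2) (Fin 2) ℤ) i j| ≤ 32 * (D : ℤ) ^ 2 + 8 * D + 2 := by
  have hj : ((x.1 : ℕ) : ℤ) + 1 ≤ D := by have := x.1.isLt; omega
  have hj0 : (0 : ℤ) ≤ (x.1 : ℕ) := by positivity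
  set m : ℤ := 4 * (((x.1 : ℕ) : ℤ) + 1) with hm
  have hm0 : 0 ≤ m := by omega
  have hmD : m ≤ 4 * D := by omega
  have key : ∀ z : ℤ, (z = 1 + 2 * m ∨ z = -(2 * m ^ 2) ∨ z = 2 ∨ z = 1 - 2 * m ∨ z = 2 * m ^ 2 ∨
      z = -2) → |z| ≤ 32 * (D : ℤ) ^ 2 + 8 * D + 2 := by
    intro z hz
    have hD0 : (0 : ℤ) ≤ D := by positivity
    have h2 : m ^ 2 ≤ 16 * (D : ℤ) ^ 2 := by nlinarith
    rcases hz with rfl | rfl | rfl | rfl | rfl | rfl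
    · rw [abs_of_nonneg (by omega)]; nlinarith
    · rw [abs_neg, abs_of_nonneg (by positivity)]; nlinarith
    · simp; nlinarith
    · rw [abs_le]; constructor <;> nlinarith
    · rw [abs_of_nonneg (by positivity)]; nlinarith
    · simp; nlinarith
  cases x.2
  · -- the inverse
    simp only [cond_false, Matrix.SpecialLinearGroup.coe_inv, gen, genMat, Matrix.adjugate_fin_two]
    apply key
    fin_cases i <;> fin_cases j <;> simp [hm]
  · simp only [cond_true, gen, genMat]
    apply key
    fin_cases i <;> fin_cases j <;> simp [hm]

/-- Entries of the image of a word of length `k` are at most `(2G)^k`, `G = 32D² + 8D + 2`. -/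
theorem abs_lift_mk_le (D : ℕ) (L : List (Fin D × Bool)) (i j : Fin 2) :
    |((FreeGroup.lift (gen D) (FreeGroup.mk L) : Matrix.SpecialLinearGroup (Fin 2) ℤ) :
        Matrix (Fin 2) (Fin 2) ℤ) i j| ≤ (2 * (32 * (D : ℤ) ^ 2 + 8 * D + 2)) ^ L.length := by
  induction L generalizing i j with
  | nil =>
    simp only [FreeGroup.lift_mk, List.map_nil, List.prod_nil, List.length_nil, pow_zero]
    fin_cases i <;> fin_cases j <;> simp
  | cons x L ih =>
    rw [FreeGroup.lift_mk, List.map_cons, List.prod_cons, List.length_cons, pow_succ]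
    rw [← FreeGroup.lift_mk]
    rw [Matrix.SpecialLinearGroup.coe_mul]
    calc _ ≤ 2 * (32 * (D : ℤ) ^ 2 + 8 * D + 2) * (2 * (32 * (D : ℤ) ^ 2 + 8 * D + 2)) ^ L.length :=
          abs_mul_entry_le (fun i j => abs_sgen_le D x i j) (fun i j => ih i j) i j
      _ = _ := by ring

/-- A nonempty reduced word is not `1` in the free group. -/
theorem mk_ne_one_of_isReduced {α : Type*} [DecidableEq α] {L : List (α × Bool)}
    (hred : FreeGroup.IsReduced L) (hne : L ≠ []) : FreeGroup.mk L ≠ 1 := by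
  intro h
  have := congrArg FreeGroup.toWord h
  rw [FreeGroup.toWord_mk, hred.reduce_eq, FreeGroup.toWord_one] at this
  exact hne this

/-- **Girth bound, matrix form.**  The image in `SL(2, ℤ/p)` of a nonempty reduced word of length `k`
is not the identity as soon as `p > (2G)^k + 1`. -/
theorem map_lift_ne_one (D : ℕ) (hD : 2 ≤ D) (p : ℕ) (L : List (Fin D × Bool))
    (hred : FreeGroup.IsReduced L) (hne : L ≠ [])
    (hp : (2 * (32 * (D : ℤ) ^ 2 + 8 * D + 2)) ^ L.length + 1 < p) :
    Matrix.SpecialLinearGroup.map (Int.castRingHom (ZMod p))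
      (FreeGroup.lift (gen D) (FreeGroup.mk L)) ≠ 1 := by
  set M := FreeGroup.lift (gen D) (FreeGroup.mk L) with hM
  have hM1 : M ≠ 1 := by
    intro h
    apply mk_ne_one_of_isReduced hred hne
    apply injective_lift_gen D hD
    rw [← hM, h, map_one]
  -- some entry of M differs from the identity
  have hentry : ∃ i j, (M : Matrix (Fin 2) (Fin 2) ℤ) i j ≠ (1 : Matrix (Fin 2) (Fin 2) ℤ) i j := by
    by_contra h
    push Not at h
    apply hM1
    ext i j
    rw [h i j, Matrix.SpecialLinearGroup.coe_one]
  obtain ⟨i, j, hij⟩ := hentry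
  intro hmap
  have h1 : (((M : Matrix (Fin 2) (Fin 2) ℤ) i j : ℤ) : ZMod p) =
      (((1 : Matrix (Fin 2) (Fin 2) ℤ) i j : ℤ) : ZMod p) := by
    have := congrArg (fun N : Matrix.SpecialLinearGroup (Fin 2) (ZMod p) =>
      (N : Matrix (Fin 2) (Fin 2) (ZMod p)) i j) hmap
    simp only [Matrix.SpecialLinearGroup.coe_one] at this
    rw [show ((Matrix.SpecialLinearGroup.map (Int.castRingHom (ZMod p)) M :
        Matrix.SpecialLinearGroup (Fin 2) (ZMod p)) : Matrix (Fin 2) (Fin 2) (ZMod p)) i j =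
        (((M : Matrix (Fin 2) (Fin 2) ℤ) i j : ℤ) : ZMod p) from rfl] at this
    rw [this]
    fin_cases i <;> fin_cases j <;> simp
  rw [ZMod.intCast_eq_intCast_iff_dvd_sub] at h1
  -- the difference is a nonzero multiple of p of absolute value < p
  have hbound : |(1 : Matrix (Fin 2) (Fin 2) ℤ) i j - (M : Matrix (Fin 2) (Fin 2) ℤ) i j| < p := by
    have hMij := abs_lift_mk_le D L i j
    rw [← hM] at hMij
    have h1ij : |(1 : Matrix (Fin 2) (Fin 2) ℤ) i j| ≤ 1 := by
      fin_cases i <;> fin_cases j <;> simp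
    calc |(1 : Matrix (Fin 2) (Fin 2) ℤ) i j - (M : Matrix (Fin 2) (Fin 2) ℤ) i j|
        ≤ |(1 : Matrix (Fin 2) (Fin 2) ℤ) i j| + |(M : Matrix (Fin 2) (Fin 2) ℤ) i j| := abs_sub _ _
      _ < p := by linarith
  obtain ⟨c, hc⟩ := h1
  have hc0 : c ≠ 0 := by
    rintro rfl; rw [mul_zero, sub_eq_zero] at hc; exact hij hc.symm
  have : (p : ℤ) ≤ |(1 : Matrix (Fin 2) (Fin 2) ℤ) i j - (M : Matrix (Fin 2) (Fin 2) ℤ) i j| := by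
    rw [hc, abs_mul, Nat.abs_cast]
    have : (1 : ℤ) ≤ |c| := Int.one_le_abs hc0
    have hp0 : (0 : ℤ) ≤ p := by positivity
    nlinarith
  linarith

/-- The image of a two-letter word `[x, x'⁻¹]` under `FreeGroup.lift`, peeled off a longer word. -/
theorem lift_mk_cons_cons_inv {G : Type*} [Group G] {D : ℕ} (f : Fin D → G) (x x' : Fin D × Bool)
    (L : List (Fin D × Bool)) :
    FreeGroup.lift f (FreeGroup.mk (x :: (x'.1, !x'.2) :: L)) =
      (cond x.2 (f x.1) (f x.1)⁻¹) * (cond x'.2 (f x'.1) (f x'.1)⁻¹)⁻¹ *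
        FreeGroup.lift f (FreeGroup.mk L) := by
  rw [FreeGroup.lift_mk, FreeGroup.lift_mk, List.map_cons, List.map_cons, List.prod_cons,
    List.prod_cons, ← mul_assoc]
  congr 2
  cases x'.2 <;> simp

/-- **Girth of the Cayley incidence (module [G]).**  Let `D ≥ 2`, `col : Fin D → Fin 2` a colouring of
the generators, `p` a modulus and `π : SL(2,ℤ) → SL(2,ℤ/p)` the reduction.  The letter incidence of
the refutation — gadget `g ∈ SL(2,ℤ/p)` carries the letters `(g · π(T_j^{±1}), col j)` — has no
closed alternating walk, non-backtracking at interior points, of length `1 ≤ L ≤ N`, provided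
`p > (2G)^{2N} + 1` (`G = 32D² + 8D + 2`): such a walk is a nonempty reduced word of length `2L` in
the free generators with trivial image, contradicting `map_lift_ne_one`. -/
theorem not_hasShortClosedWalk_cayley (D : ℕ) (hD : 2 ≤ D) (col : Fin D → Fin 2) (p : ℕ) (N : ℕ)
    (hp : (2 * (32 * (D : ℤ) ^ 2 + 8 * D + 2)) ^ (2 * N) + 1 < p) :
    ¬ HasShortClosedWalk
      (fun g : Matrix.SpecialLinearGroup (Fin 2) (ZMod p) =>
        Finset.univ.image (fun x : Fin D × Bool =>
          (g * Matrix.SpecialLinearGroup.map (Int.castRingHom (ZMod p))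
            (cond x.2 (gen D x.1) (gen D x.1)⁻¹), col x.1))) N := by
  classical
  rintro ⟨L, hL1, hLN, g, m, hclosed, hstep, hnb⟩
  set π := Matrix.SpecialLinearGroup.map (n := Fin 2) (Int.castRingHom (ZMod p)) with hπ
  let sg : Fin D × Bool → Matrix.SpecialLinearGroup (Fin 2) ℤ :=
    fun x => cond x.2 (gen D x.1) (gen D x.1)⁻¹
  -- the two generators seen by each step
  have hx : ∀ i, i < L → ∃ x : Fin D × Bool, g i * π (sg x) = (m i).1 ∧ col x.1 = (m i).2 := by
    intro i hi
    obtain ⟨h1, -, -⟩ := hstep i hi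
    obtain ⟨x, -, hxe⟩ := Finset.mem_image.mp h1
    exact ⟨x, (congrArg Prod.fst hxe), (congrArg Prod.snd hxe)⟩
  have hx' : ∀ i, i < L → ∃ x : Fin D × Bool, g (i + 1) * π (sg x) = (m i).1 ∧ col x.1 = (m i).2 := by
    intro i hi
    obtain ⟨-, h2, -⟩ := hstep i hi
    obtain ⟨x, -, hxe⟩ := Finset.mem_image.mp h2
    exact ⟨x, (congrArg Prod.fst hxe), (congrArg Prod.snd hxe)⟩
  haveI : Nonempty (Fin D × Bool) := ⟨(⟨0, by omega⟩, true)⟩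
  choose! X hX using hx
  choose! X' hX' using hx'
  -- relation of reducedness between the letters
  let R : Fin D × Bool → Fin D × Bool → Prop := fun a b => a.1 = b.1 → a.2 = b.2
  have hR1 : ∀ i, i < L → R (X i) ((X' i).1, !(X' i).2) := by
    intro i hi h1
    by_contra h2
    have heq : X i = X' i := Prod.ext h1 (by cases hb : (X i).2 <;> cases hb' : (X' i).2 <;> simp_all)
    obtain ⟨-, -, hne⟩ := hstep i hi
    apply hne
    have e1 := (hX i hi).1; have e2 := (hX' i hi).1
    rw [heq] at e1
    exact mul_right_cancel (e1.trans e2.symm)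
  have hR2 : ∀ i, i + 1 < L → R ((X' i).1, !(X' i).2) (X (i + 1)) := by
    intro i hi h1
    by_contra h2
    have heq : X (i + 1) = X' i :=
      Prod.ext h1.symm (by cases hb : (X (i+1)).2 <;> cases hb' : (X' i).2 <;> simp_all)
    apply hnb i hi
    have e1 := hX' i (by omega); have e2 := hX (i + 1) hi
    rw [heq] at e2
    exact Prod.ext (e1.1.symm.trans e2.1) (e1.2.symm.trans e2.2)
  -- the word of the last k steps
  let aux : ℕ → List (Fin D × Bool) := fun k =>
    Nat.rec [] (fun k ih => X (L - k - 1) :: ((X' (L - k - 1)).1, !(X' (L - k - 1)).2) :: ih) k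
  have aux_zero : aux 0 = [] := rfl
  have aux_succ : ∀ k, aux (k + 1) =
      X (L - k - 1) :: ((X' (L - k - 1)).1, !(X' (L - k - 1)).2) :: aux k := fun k => rfl
  have hlen : ∀ k, (aux k).length = 2 * k := by
    intro k; induction k with
    | zero => rfl
    | succ k ih => rw [aux_succ, List.length_cons, List.length_cons, ih]; ring
  have hred : ∀ k, k ≤ L → FreeGroup.IsReduced (aux k) := by
    intro k
    induction k with
    | zero => intro _; rw [aux_zero]; exact FreeGroup.IsReduced.nil
    | succ k ih =>
      intro hk
      rw [aux_succ, FreeGroup.isReduced_cons_cons]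
      refine ⟨hR1 _ (by omega), ?_⟩
      rcases Nat.eq_zero_or_pos k with h0 | h0
      · subst h0; rw [aux_zero]; exact FreeGroup.IsReduced.singleton
      · obtain ⟨k', rfl⟩ : ∃ k', k = k' + 1 := ⟨k - 1, by omega⟩
        rw [aux_succ, FreeGroup.isReduced_cons_cons, ← aux_succ]
        refine ⟨?_, ih (by omega)⟩
        have := hR2 (L - (k' + 1) - 1) (by omega)
        rwa [show L - (k' + 1) - 1 + 1 = L - k' - 1 by omega] at this
  have hprod : ∀ k, k ≤ L → π (FreeGroup.lift (gen D) (FreeGroup.mk (aux k))) = (g (L - k))⁻¹ * g L := by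
    intro k
    induction k with
    | zero => intro _; rw [aux_zero]; simp
    | succ k ih =>
      intro hk
      rw [aux_succ, lift_mk_cons_cons_inv, map_mul, map_mul, map_inv, ih (by omega)]
      have e1 := (hX (L - k - 1) (by omega)).1
      have e2 := (hX' (L - k - 1) (by omega)).1
      rw [show L - k - 1 + 1 = L - k by omega] at e2
      -- π(sg X) π(sg X')⁻¹ = g(n)⁻¹ g(n+1)
      have e3 : π (sg (X (L - k - 1))) * (π (sg (X' (L - k - 1))))⁻¹ =
          (g (L - k - 1))⁻¹ * g (L - k) := by
        have hv : g (L - k) = g (L - k - 1) * π (sg (X (L - k - 1))) * (π (sg (X' (L - k - 1))))⁻¹ := by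
          rw [e1, ← e2, mul_inv_cancel_right]
        rw [hv, mul_assoc (g (L - k - 1)), inv_mul_cancel_left]
      rw [show L - (k + 1) = L - k - 1 by omega]
      rw [show (cond (X (L - k - 1)).2 (gen D (X (L - k - 1)).1) (gen D (X (L - k - 1)).1)⁻¹) =
        sg (X (L - k - 1)) from rfl,
        show (cond (X' (L - k - 1)).2 (gen D (X' (L - k - 1)).1) (gen D (X' (L - k - 1)).1)⁻¹) =
        sg (X' (L - k - 1)) from rfl, e3]
      group
  -- conclude with the matrix girth bound
  have hne : aux L ≠ [] := by
    obtain ⟨L', rfl⟩ : ∃ L', L = L' + 1 := ⟨L - 1, by omega⟩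
    rw [aux_succ]; exact List.cons_ne_nil _ _
  have hp' : (2 * (32 * (D : ℤ) ^ 2 + 8 * D + 2)) ^ (aux L).length + 1 < p := by
    have hbase : (1 : ℤ) ≤ 2 * (32 * (D : ℤ) ^ 2 + 8 * D + 2) := by
      have : (0 : ℤ) ≤ 32 * (D : ℤ) ^ 2 + 8 * D := by positivity
      linarith
    have hmono : (2 * (32 * (D : ℤ) ^ 2 + 8 * D + 2)) ^ (aux L).length ≤
        (2 * (32 * (D : ℤ) ^ 2 + 8 * D + 2)) ^ (2 * N) :=
      pow_le_pow_right₀ hbase (by rw [hlen]; omega)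
    linarith
  have := map_lift_ne_one D hD p (aux L) (hred L le_rfl) hne hp'
  apply this
  rw [← hπ, hprod L le_rfl, Nat.sub_self, hclosed, inv_mul_cancel]


end Summit.ValiantsHypothesis.ValiantsHypothesis.Theorems.PeelingLemmaSchottky
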